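/-
Copyright: cell `pub-balaban-gaps` (G2), seat ne6 (row NE7b), `prover-pub-balaban-gaps-ne6-g13-0`, on leaf-01 g80's `CompactFibreRelative`
(OWNER lineage `t4-ne7b-p1` g106's `CompactFibreCarrier`) and lit-balaban's as-printed `B16Sect1Kernels`. Project licence.
-/
import Summits.QuantumFields.BalabanUV.T4Continuum.Spine.NE7b.CompactFibreRelative
import Literature.MathematicalPhysics.QuantumFieldTheory.Balaban1983to89.B16Sect1Kernels

/-!
# THE (n)-CARRIER'S PRICE AT A CREATION STEP WITH THE WINDOW-COMPLEMENT FLOOR: `e^{i₀ − a}·(∫F dκ ∕ κ(W))`, `a = (λ∕2)δ′²`,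
# and the same in print's (1.77)∕(1.78) letters: `a = γ₀W⁻¹(A₁p₁)² − c` (row NE7b, node U5c; MODEL-level junction, [folklore])

Cell `pub-balaban-gaps` (G2 spine census, V24) for the `pub-balaban` T⁴ crux NE7b (`T4WeightBudget.RelWeightBound`; the cell's OWN estimate —
NOT PRINTED in [Bałaban 1983–89], NOT PROVED).  Crux-route work under `Spine/NE7b/`; NOTHING of Bałaban's is named as a hypothesis or
asserted; no `def`; zero `sorry`.  Imports (hub ∕ farm oleans present): leaf-01's `…NE7b.CompactFibreRelative` (the fibrewise-relative compact
sandwich `relFibre_moment_le_of_centredWindow`) and lit-balaban's `…Balaban1983to89.B16Sect1Kernels` (as-printed (1.77)∕(1.78) of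
[Balaban1989LargeFieldII] p. 383 with the PROVED arithmetic `form_lower_of_large_bond`).

WHY.  `CompactFibreRelative.relFibre_moment_le_of_centredWindow` prices the numerator of a creation ∕ renewal step RELATIVE to a fibrewise
level `m(y)`: `∫ F·w·e^{−I} ≤ e^{i₀}·(∫F dκ ∕ κ(W))·∫ G·w·e^{−I}`, with `hnum : m y ≤ I` on the numerator's support and the excess `i₀` of `I`
over `m y` on the centred window; its docstring notes that a large-field FLOOR `a` on the numerator's support «rides in `m(y) := m₀(y) + a`
and turns the excess into `i₀ − a`» (the refuter's shift β-ne7bref-g69-1).  Print's creation-step large-field event is the COMPLEMENT OF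
THE WINDOW ITSELF — [Balaban1989LargeFieldI] p. 196 (1.82) «`χ′ = χ({|B′(b)| < δ′_k for b ∈ 𝔹₀})`», «we exclude from Z the components with
the large field function `1 − χ′`» — so the floor is `θ`-free: SOME bond deviates by `≥ δ′` from the centre, and a displayed bond-quadratic
convexity floor of modulus `λ` gives `a = (λ∕2)δ′²` (this seat's `NestedWindows.hnum_of_window_complement` ∕ `sq_le_sum_sq_of_exists_abs_ge`, v2 §5b — the two-line
argument is inlined in §1's proof to keep this file independent of that module's olean).  Print's instance of the floor is [Balaban1989LargeFieldII] p. 383: (1.77)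
«`⟨DH″B, ζDH″B⟩ > γ₀Σ_{p′}|(∂B)(p′)|² − O(1)A₀A₁²B₃⁴B₅M^{d+6}R_j^{d+3}p₀(g_j)p₁²(g_j)g_j`», (1.78) «`|B(b)|² ≦ 6(d+3)(100M(L+1)N^{β₀}R_j)^{d+2}
Σ_{p′}|(∂B)(p′)|²`», «We take the bond `b`, for which `|B(b)| ≧ g_j⁻¹δ′_j = A₁p₁(g_j)`, and the inequalities (1.77), (1.78) yield the following
large field factor: `exp(−½γ₀[6(d+3)(100M(L+1)N^{β₀}R_j)^{d+2}]⁻¹A₁²p₁²(g_j))`» — typed AS PRINTED in the tree (`Ineq177`, `Ineq178`; (1.78)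
itself PROVED for boxes ∕ the nested tree gauge in `B16Ineq178Box` ∕ `B16Ineq178Nested`; `γ₀` = GAPS G-B9-09, asserted-not-proved in print).

WHAT IS PROVED ([folklore]):
* §1 **`relFibre_moment_le_of_windowComplementFloor`** — CFR's centred-window
  sandwich with the numerator supported in the window complement (`hF : ∃ b ∈ s, δ′ ≤ |dev y x b|`) and a displayed bond-quadratic floor
  (`hconv : m₀ y + (λ∕2)·Σ_b (dev y x b)² ≤ I (x, y)` there), the window excess `i₀` measured from the SAME base level `m₀ y`:
  `∫ F·w·e^{−I} d(κ⊗μ) ≤ e^{i₀ − (λ∕2)δ′²}·(∫F dκ ∕ κ(W))·∫ G·w·e^{−I} d(κ⊗μ)`.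
* §2 **`relFibre_moment_le_of_ineq177_178`** — the same with the floor in print's letters: per live fibre and numerator point, a form value
  `Q` with `m₀ y + Q ≤ I (x, y)` (the action's excess over the base level dominates the fluctuation form — (A3)), (1.77)'s shape
  `γ₀·ndB − c < Q`, (1.78)'s shape `nb ≤ W·ndB` for the large bond and `(A₁p₁)² ≤ nb` (the event): price `e^{i₀ + c − γ₀W⁻¹(A₁p₁)²}·(∫F dκ ∕ κ(W))`
  (`B16Sect1Kernels.form_lower_of_large_bond` BY NAME).
* §3 LEDGER ARITHMETIC: `price_le_exp_neg_iff` (`e^{i₀ − a}·V ≤ e^{−P} ↔ log V + i₀ + P ≤ a` for `V > 0`), `price_le_exp_neg_of_volumeLetter`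
  (with a volume letter `log V ≤ b_vol`, e.g. pub-balaban-gaps ne6's `CompactFibreWindowSU2.neg_log_pi_traceWindow_le`: the step sells `e^{−P}` as soon
  as `a ≥ P + i₀ + b_vol`), `print_floor_half` (`(γ₀W⁻¹∕2)·(A₁p₁)² = ½γ₀W⁻¹A₁²p₁²`: print's displayed exponent is §1's `(λ∕2)δ′²` at `λ = γ₀W⁻¹`, `δ′ = A₁p₁`),
  `print_exponent_eq`.
* §4 toy (one-point fibre and far space are not needed: a two-element check of §3's arithmetic).

HONEST REMARKS.  MODEL ∕ junction only.  NOT HERE: that Bałaban's 𝐑-quotient IS of CFR's form, which factors are `F, G, w`, that the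
denominator's windows contain the centred `W` (`hGwin`), the identification of `I − m₀` with the fluctuation form of (1.77) and the values
of `γ₀` (GAPS G-B9-09 — «Localizing the operators … we can prove it», not proved in print; the leaves' `AdmissibleFloorIMS` road), of the
(1.77) correction `c`, of `i₀` (this seat's `CompactFibreWindowCentred`: `(β∕2)(4ρ)(2s + 4ρ)` per plaquette in the SU(2) model) and of
`κ(W)` (this seat's `CompactFibreWindowSU2 ∕ SUN`) FOR BAŁABAN's STEP — all (A3) ∕ (A1c), NC-NE7b-α UNRULED.  BY-NAME EFFECT ON THE WALL:
NONE.  NE7b NOT PRINTED ∕ NOT PROVED; spine PROVED 0∕9; rung (B)+1 on ONE finite T⁴ — NOT infinite volume, NOT the mass gap, NOT Clay.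
HONEST DEPENDENCY: continuum YM on T⁴ ⇐ BetaPertH ∧ nine spine estimates (0/9 proved); BetaPertH ⇐ (D1) ∧ (D4) ∧ CAP+tail;
G-an2-4 gates asym, D1 and NE2/3/4.  This file changes none of it.
-/

set_option autoImplicit false

open MeasureTheory Real Finset
open Summit.QuantumFields.BalabanUV.T4Continuum.NE7b.CompactFibreRelative (relFibre_moment_le_of_centredWindow)
open Literature.MathematicalPhysics.QuantumFieldTheory.Balaban1983to89.B16Sect1Kernels (form_lower_of_large_bond)

namespace Summit.QuantumFields.BalabanUV.T4Continuum.NE7b.CompactFibreCreationFloor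

/-! ## §1 The window-complement floor inside the fibrewise-relative sandwich -/

section WindowComplement

variable {K Y B : Type*} [MeasurableSpace K] [MeasurableSpace Y] (κ : Measure K) (μ : Measure Y)
variable [Group K] [MeasurableMul K] [κ.IsMulLeftInvariant] [SFinite κ] [SFinite μ]

/-- **THE (n)-CARRIER'S PRICE WITH THE WINDOW-COMPLEMENT FLOOR.**  CFR's centred-window sandwich on a group fibre (`F ≥ 0` integrable,
`G ≥ 0`, `w ≥ 0`, centre `U₀ : Y → K`, one measurable window `W` of positive mass, `hGwin`, integrabilities — all as in
`relFibre_moment_le_of_centredWindow`) with, per live fibre `y` (`w y ≠ 0`): a base level `m₀ y` such that the interaction's excess over it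
on the centred window is `≤ i₀` (`hIrel`), the numerator supported where SOME bond of a finite bond set `s` deviates from the centre by `≥ δ′`
in a reading `dev y x b` (`hF` — print's event `1 − χ′`), and a displayed bond-quadratic convexity floor of modulus `λ ≥ 0` on that event
(`hconv`).  Then `∫ F·w·e^{−I} ≤ e^{i₀ − (λ∕2)δ′²}·(∫F dκ ∕ κ(W))·∫ G·w·e^{−I}`: the floor DISCOUNTS the excess, `θ`-free. [folklore] -/
theorem relFibre_moment_le_of_windowComplementFloor (F G : K → ℝ) (w : Y → ℝ) (I : K × Y → ℝ) (m₀ : Y → ℝ) (U₀ : Y → K)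
    (W : Set K) (s : Finset B) (dev : Y → K → B → ℝ) {i₀ lam δ' : ℝ}
    (hF0 : ∀ x, 0 ≤ F x) (hG0 : ∀ x, 0 ≤ G x) (hw0 : ∀ y, 0 ≤ w y) (hW : MeasurableSet W) (hWpos : 0 < κ.real W)
    (hlam : 0 ≤ lam) (hδ : 0 ≤ δ')
    (hF : ∀ x y, F x ≠ 0 → w y ≠ 0 → ∃ b ∈ s, δ' ≤ |dev y x b|)
    (hconv : ∀ x y, F x ≠ 0 → w y ≠ 0 → m₀ y + lam / 2 * ∑ b ∈ s, dev y x b ^ 2 ≤ I (x, y))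
    (hGwin : ∀ y v, w y ≠ 0 → v ∈ W → 1 ≤ G (U₀ y * v))
    (hIrel : ∀ y v, w y ≠ 0 → v ∈ W → I (U₀ y * v, y) ≤ m₀ y + i₀)
    (hFi : Integrable F κ) (hGI : ∀ y, w y ≠ 0 → Integrable (fun x => G x * exp (-I (x, y))) κ)
    (hA' : Integrable (fun z : K × Y => F z.1 * w z.2 * exp (-I z)) (κ.prod μ))
    (hB' : Integrable (fun z : K × Y => G z.1 * w z.2 * exp (-I z)) (κ.prod μ)) :
    ∫ z, F z.1 * w z.2 * exp (-I z) ∂(κ.prod μ) ≤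
      (exp (i₀ - lam / 2 * δ' ^ 2) * ((∫ x, F x ∂κ) / κ.real W)) * ∫ z, G z.1 * w z.2 * exp (-I z) ∂(κ.prod μ) := by
  -- the floor rides in the level: `m y := m₀ y + (λ∕2)δ′²`, excess `i₀ − (λ∕2)δ′²`
  refine relFibre_moment_le_of_centredWindow κ μ F G w I (fun y => m₀ y + lam / 2 * δ' ^ 2) U₀ W hF0 hG0 hw0 hW hWpos
    (fun x y hx hy => ?_) hGwin (fun y v hy hv => ?_) hFi hGI hA' hB'
  · -- one bond outside the window already carries `δ′²` (= `NestedWindows.sq_le_sum_sq_of_exists_abs_ge`, inlined to spare the import)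
    obtain ⟨b, hb, hle⟩ := hF x y hx hy
    have hsq : δ' ^ 2 ≤ ∑ b ∈ s, dev y x b ^ 2 :=
      ((pow_le_pow_left₀ hδ hle 2).trans_eq (sq_abs _)).trans
        (Finset.single_le_sum (f := fun b => dev y x b ^ 2) (fun b _ => sq_nonneg _) hb)
    have := mul_le_mul_of_nonneg_left hsq (by positivity : 0 ≤ lam / 2)
    linarith [hconv x y hx hy]
  · have := hIrel y v hy hv
    linarith

end WindowComplement

/-! ## §2 The same floor in print's (1.77)∕(1.78) letters -/

section Printed

variable {K Y B : Type*} [MeasurableSpace K] [MeasurableSpace Y] (κ : Measure K) (μ : Measure Y)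
variable [Group K] [MeasurableMul K] [κ.IsMulLeftInvariant] [SFinite κ] [SFinite μ]

/-- **THE (n)-CARRIER'S PRICE WITH PRINT'S (1.77)∕(1.78) FLOOR.**  As §1, but the floor is displayed in the letters of
[Balaban1989LargeFieldII] p. 383: per live fibre `y` and numerator point `x`, a form value `Q y x` with `m₀ y + Q y x ≤ I (x, y)` (the
action's excess over the base level dominates the fluctuation form — an (A3) letter), a plaquette sum `ndB y x` with (1.77)'s shape
`γ₀·ndB − c < Q` (`γ₀ ≥ 0`), and a LARGE bond `b ∈ s` with (1.78)'s shape `nb y x b ≤ W·ndB` (`W > 0`) and `(A₁p₁)² ≤ nb y x b` (the event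
«`|B(b)| ≧ A₁p₁(g_j)`»).  Then `∫ F·w·e^{−I} ≤ e^{i₀ + c − γ₀W⁻¹(A₁p₁)²}·(∫F dκ ∕ κ(W))·∫ G·w·e^{−I}` — print's large-field factor
against the window's excess and volume (print displays `exp(−½γ₀W⁻¹A₁²p₁²)`: the action carries `½⟨DH″B, ζDH″B⟩`, so its `Q` is HALF the
form of (1.77) and `γ₀, c` enter halved — the same statement with `γ₀∕2`, `c∕2`).  `B16Sect1Kernels.form_lower_of_large_bond` BY NAME. [folklore] -/
theorem relFibre_moment_le_of_ineq177_178 (F G : K → ℝ) (w : Y → ℝ) (I : K × Y → ℝ) (m₀ : Y → ℝ) (U₀ : Y → K)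
    (W : Set K) (s : Finset B) (Q ndB : Y → K → ℝ) (nb : Y → K → B → ℝ) {i₀ γ₀ Wc c A₁ p₁ : ℝ}
    (hF0 : ∀ x, 0 ≤ F x) (hG0 : ∀ x, 0 ≤ G x) (hw0 : ∀ y, 0 ≤ w y) (hW : MeasurableSet W) (hWpos : 0 < κ.real W)
    (hγ₀ : 0 ≤ γ₀) (hWc : 0 < Wc)
    (hQ : ∀ x y, F x ≠ 0 → w y ≠ 0 → m₀ y + Q y x ≤ I (x, y))
    (h77 : ∀ x y, F x ≠ 0 → w y ≠ 0 → γ₀ * ndB y x - c < Q y x)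
    (h78 : ∀ x y, F x ≠ 0 → w y ≠ 0 → ∃ b ∈ s, nb y x b ≤ Wc * ndB y x ∧ (A₁ * p₁) ^ 2 ≤ nb y x b)
    (hGwin : ∀ y v, w y ≠ 0 → v ∈ W → 1 ≤ G (U₀ y * v))
    (hIrel : ∀ y v, w y ≠ 0 → v ∈ W → I (U₀ y * v, y) ≤ m₀ y + i₀)
    (hFi : Integrable F κ) (hGI : ∀ y, w y ≠ 0 → Integrable (fun x => G x * exp (-I (x, y))) κ)
    (hA' : Integrable (fun z : K × Y => F z.1 * w z.2 * exp (-I z)) (κ.prod μ))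
    (hB' : Integrable (fun z : K × Y => G z.1 * w z.2 * exp (-I z)) (κ.prod μ)) :
    ∫ z, F z.1 * w z.2 * exp (-I z) ∂(κ.prod μ) ≤
      (exp (i₀ + c - γ₀ * Wc⁻¹ * (A₁ * p₁) ^ 2) * ((∫ x, F x ∂κ) / κ.real W)) *
        ∫ z, G z.1 * w z.2 * exp (-I z) ∂(κ.prod μ) := by
  -- the level carries print's floor: `m y := m₀ y + (γ₀W⁻¹(A₁p₁)² − c)`, excess `i₀ + c − γ₀W⁻¹(A₁p₁)²`
  refine relFibre_moment_le_of_centredWindow κ μ F G w I (fun y => m₀ y + (γ₀ * Wc⁻¹ * (A₁ * p₁) ^ 2 - c)) U₀ W hF0 hG0 hw0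
    hW hWpos (fun x y hx hy => ?_) hGwin (fun y v hy hv => ?_) hFi hGI hA' hB'
  · obtain ⟨b, _, h78b, hbig⟩ := h78 x y hx hy
    have hfloor : γ₀ * Wc⁻¹ * (A₁ * p₁) ^ 2 - c < Q y x := form_lower_of_large_bond hWc hγ₀ h78b (h77 x y hx hy) hbig
    linarith [hQ x y hx hy]
  · have := hIrel y v hy hv
    linarith

end Printed

/-! ## §3 Ledger arithmetic: when does the step sell `e^{−P}`? -/

section Ledger

/-- `e^{i₀ − a}·V ≤ e^{−P} ↔ log V + i₀ + P ≤ a` for a positive volume letter `V` (= `∫F dκ ∕ κ(W)`). [folklore] -/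
theorem price_le_exp_neg_iff {i₀ a V P : ℝ} (hV : 0 < V) : exp (i₀ - a) * V ≤ exp (-P) ↔ Real.log V + i₀ + P ≤ a := by
  rw [← Real.exp_log hV, ← Real.exp_add, Real.exp_le_exp, Real.exp_log hV]
  constructor <;> intro h <;> linarith

/-- With a volume LETTER `log V ≤ b_vol` (for the SU(2) product window: `−log κ(Π_b W_η) ≤ #bonds·(2 log η⁻¹ + log 16)`, pub-balaban-gaps ne6's
`CompactFibreWindowSU2.neg_log_pi_traceWindow_le`, and `∫F dκ ≤ 1`): the step sells `e^{−P}` as soon as `P + i₀ + b_vol ≤ a`. [folklore] -/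
theorem price_le_exp_neg_of_volumeLetter {i₀ a V P bvol : ℝ} (hV : 0 < V) (hvol : Real.log V ≤ bvol) (ha : P + i₀ + bvol ≤ a) :
    exp (i₀ - a) * V ≤ exp (-P) :=
  (price_le_exp_neg_iff hV).2 (by linarith)

/-- Print's displayed exponent in §1's currency: `½γ₀W⁻¹A₁²p₁² = (λ∕2)·δ′²` at `λ = γ₀W⁻¹`, `δ′ = A₁p₁` — print's factor
`exp(−½γ₀W⁻¹A₁²p₁²)` IS §1's `e^{−(λ∕2)δ′²}`. [folklore] -/
theorem print_floor_half (γ₀ Wc A₁ p₁ : ℝ) : (γ₀ * Wc⁻¹) / 2 * (A₁ * p₁) ^ 2 = 1 / 2 * γ₀ * Wc⁻¹ * A₁ ^ 2 * p₁ ^ 2 := by ring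

/-- The §2 price exponent rewritten: `i₀ + c − γ₀W⁻¹(A₁p₁)² = (i₀ + c) − a` with `a = γ₀W⁻¹(A₁p₁)²` (so §3's ledger applies with the
excess `i₀ + c`). [folklore] -/
theorem print_exponent_eq (i₀ c γ₀ Wc A₁ p₁ : ℝ) :
    i₀ + c - γ₀ * Wc⁻¹ * (A₁ * p₁) ^ 2 = (i₀ + c) - γ₀ * Wc⁻¹ * (A₁ * p₁) ^ 2 := by ring

end Ledger

/-! ## §4 Sanity: the ledger is not vacuous -/

/-- Toy: volume letter `V = e²` (`log V = 2`), excess `i₀ = 1`, target `P = 3`, floor `a = 6 = P + i₀ + log V` — the step sells exactly `e^{−3}`. -/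
example : exp ((1 : ℝ) - 6) * exp 2 ≤ exp (-3) :=
  price_le_exp_neg_of_volumeLetter (exp_pos 2) (by rw [Real.log_exp]) (by norm_num)

end Summit.QuantumFields.BalabanUV.T4Continuum.NE7b.CompactFibreCreationFloor
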